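import Summits.QuantumFields.BalabanUV.Beta.FP.TorusCompositeInsertionKernelSingle

/-!
# `BalabanUV.Beta.FP.TorusCompositeInsertionKernelPacked` — road «FP» for binder row D1, ROUTE T: **R-9 ∕ R-10 ∕ R-11 AT PACKED BORDER FAMILIES** — the (S3-2)
# Q-sockets for a family `𝒱 κ′ u := cu • packVH K (Lc^n) κ′ u` (an1's packer of a border kernel at the tower's blocking; an2 F3's `compVhS … := packVH (compVHKer …) (L^m)`
# shape) whose kernel functional IS the functional of our chain rule: the kernel clauses `h𝒱 ∕ h𝒲` and the windows `hS ∕ hT ∕ hT′` of R-9∕R-10 DISCHARGED from the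
# packer's entries (`packVH_inr_inl`, `off_zsmul`, `blk_zsmul`) and the kernel's windows — so F4 ∕ F5's torus face is ONE application per order

WHY.  R-9 `sum_mul_perZ_dper_eq_compIns₁_apply` (order 1) and R-10 `sum_sum_mul_tsum₂_eq_compIns₂₂_apply` ∕ R-11 (order 2) take an abstract `MKer` family with a
kernel clause (`h𝒱 ∕ h𝒲`: its `(inr κ, inl l)` border entries at the coarse multiplier sites pair to the functional) and windows.  The row's families ARE packers:
`packVH K N κ′ u` has `(inr μ, inl α)` entry `[off N x = 0] · K μ (blk N x) (α, z) (κ′, u)` (an1 `AveragingHessianKernels` :1148), so at `x = N • x̄` the entry is the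
border kernel itself; R-13 `CompositeKernelFunctionalStep` makes «the functional IS the kernel functional» the row's DEFINITION of `𝓘₁ ∕ 𝓘₂` (shape (a)).  THIS FILE:
§1 `sum_mul_perZ_dper_packVH_eq_compIns₁_apply` — R-9 for `𝒱 := cu • packVH K (Lc^n)` under: the clauses `h0 ∕ hsucc`, the kernel-functional identity `h𝓘` at depth
`n` with unit `cu`, the kernel's windows `hKz ∕ hKu` (indexed by the COARSE site), the packed family's block covariance `hVt` (an2 F3 `compVhS_translate`'s shape);
+ `perZ_dper_packVH_eq_compIns₁_apply_single` (one lattice-labelled bond, every box).  §2 the ORDER-2 twins for `𝒲 κ u κ′ u′ := cu • packVH (fun μ y f f′ => K₂ μ y f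
(κ,u) f′) (Lc^n) κ′ u′` (an2 F5's `compVh2S` shape): the all-pairs identity, and the socket form under the `K₀` guard (`…_of_diam`).  [folklore] BY NAME; no `def`,
nothing cited, 0 sorry; NO chart; the kernels `K ∕ K₂`, units, windows and functionals are HYPOTHESES (the row's F3∕F5 + R-13); nothing of Bałaban's asserted.

HONEST DEPENDENCY (page 1, mandatory): continuum YM on T⁴ ⇐ BetaPertH ∧ nine spine estimates (0/9 proved); BetaPertH ⇐ (D1) ∧ (D4) ∧ CAP+tail;
G-an2-4 gates asym, D1 and NE2/3/4.  HONEST FRAMING (cell contract, verbatim): «discharging `BetaPertH` makes Bałaban's UV stability UNCONDITIONAL —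
a real constructive-QFT result; it is NOT the continuum limit and NOT the Clay problem.»  ABSOLUTE RULE (cell charter, verbatim): «No internally-minted
statement may enter as a cited fact. Every hypothesis is either kernel-proved in this package or a verbatim quotation of a PUBLISHED theorem with page
reference. The manuscript(s) under audit are NOT citable for their own disputed steps — they are the thing under adjudication; programme-internal
(2001/route/tribunal) claims are never citable.»  0 estimates; 0∕4 row-D1 binders (hW, hR, D1Tel, D1Rep); NOT (T-ID), NOT (C1), NOT SDF, NOT D1,
NOT BetaPertH, NOT continuum, NOT Clay.  D1 formalisation swarm LEAF PROVER 02 (b2b-balaban-beta-d1-formalise-leaf-02 gen 29), 2026-08-23.  No existing file touched.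
-/

noncomputable section

open scoped BigOperators

namespace Summit.QuantumFields.BalabanUV.Beta.FP.TorusCompositeInsertionKernelPacked

open Matrix Finset
open Literature.MathematicalPhysics.QuantumFieldTheory
open Literature.MathematicalPhysics.QuantumFieldTheory.Balaban1983to89
open Literature.MathematicalPhysics.QuantumFieldTheory.Balaban1983to89.Beta
open B5Prop11Plancherel (fine)
open B6Lemma24Torus (pbox)
open B4TorusKernel.MultiPeriod (translate)
open ExpKernelCalculus (MKer shiftK)
open AffineAveraging (Site Form1 box toSite)
open AveragingContours (off blk)
open AveragingContoursRooted (linAvgAt)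
open AveragingHessianKernels (Bond packVH packVH_inr_inl)
open AveragingHessianKernelsRooted (vhKerAt)
open AveragingMixedJetTables (vh2KerAt)
open OneStepResolventKernel (Fib)
open Summit.QuantumFields.BalabanUV.Beta.BorderedHessian (stepScale)
open Summit.QuantumFields.BalabanUV.Beta.FP.KernelPeriodisationFib (perZ)
open Summit.QuantumFields.BalabanUV.Beta.FP.KernelPeriodisationFibLoc (dper)
open Summit.QuantumFields.BalabanUV.Beta.FP.CompositeBorderTables (off_zsmul blk_zsmul)
open Summit.QuantumFields.BalabanUV.Beta.FP.TorusGaugeCovariancePairing (wrapPt)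
open Summit.QuantumFields.BalabanUV.Beta.FP.TorusCompositeObjects (towerTorus)
open Summit.QuantumFields.BalabanUV.Beta.CompositeAveragingCoarseExact (compLinAvgAt)
open Summit.QuantumFields.BalabanUV.Beta.FP.TorusCompositeCovarianceOne (compIns₁)
open Summit.QuantumFields.BalabanUV.Beta.FP.TorusCompositeCovarianceTwoPolar (compIns₂₂)
open Summit.QuantumFields.BalabanUV.Beta.FP.TorusCompositeInsertionKernel (sum_mul_perZ_dper_eq_compIns₁_apply)
open Summit.QuantumFields.BalabanUV.Beta.FP.TorusCompositeInsertionKernelTwo (sum_sum_mul_tsum₂_eq_compIns₂₂_apply)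
open Summit.QuantumFields.BalabanUV.Beta.FP.TorusCompositeInsertionKernelSingle (perZ_dper_eq_compIns₁_apply_single perZ_dper_eq_compIns₂₂_apply_single_of_diam)

variable {d : ℕ} (Lc : ℕ) [NeZero Lc]

omit [NeZero Lc] in
/-- [folklore] the packer's border entry AT A COARSE MULTIPLIER SITE is the kernel: `(cu • packVH K N κ′ u) (N • x̄) z (inr μ) (inl α) = cu · K μ x̄ (α, z) (κ′, u)` (`1 ≤ N`). -/
theorem smul_packVH_zsmul_inr_inl {N : ℕ} (hN : 1 ≤ N) (K : Fin (d + 1) → Site (d + 1) → Bond (d + 1) → Bond (d + 1) → ℝ) (cu : ℝ)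
    (κ' : Fin (d + 1)) (u x z : Site (d + 1)) (μ α : Fin (d + 1)) :
    (cu • packVH K N κ' u) ((N : ℤ) • x) z (Sum.inr μ) (Sum.inl α) = cu * K μ x (α, z) (κ', u) := by
  simp only [Pi.smul_apply, smul_eq_mul, packVH_inr_inl, off_zsmul, blk_zsmul hN, if_true]

omit [NeZero Lc] in
/-- [folklore] the packer's `(inr, inl)` entries vanish with the kernel's (whether or not the first slot is a coarse site). -/
theorem smul_packVH_inr_inl_eq_zero (N : ℕ) (K : Fin (d + 1) → Site (d + 1) → Bond (d + 1) → Bond (d + 1) → ℝ) (cu : ℝ)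
    (κ' : Fin (d + 1)) (u x z : Site (d + 1)) (μ α : Fin (d + 1)) (hK : K μ (blk N x) (α, z) (κ', u) = 0) :
    (cu • packVH K N κ' u) x z (Sum.inr μ) (Sum.inl α) = 0 := by
  simp only [Pi.smul_apply, smul_eq_mul, packVH_inr_inl, hK, ite_self, mul_zero]

/-! ## §1 Order 1: R-9 at a packed border family -/

section OrderOne

variable
    (𝓘 : (ℕ → ℕ) → (ℕ → (Fin (d + 1) → ℕ)) → ℕ → Form1 (d + 1) ℝ → Form1 (d + 1) ℝ → Form1 (d + 1) ℝ)
    (h0 : ∀ (lev : ℕ → ℕ) (rs : ℕ → (Fin (d + 1) → ℕ)) (H B : Form1 (d + 1) ℝ), 𝓘 lev rs 0 H B = 0)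
    (hsucc : ∀ (lev : ℕ → ℕ) (rs : ℕ → (Fin (d + 1) → ℕ)) (n : ℕ) (H B : Form1 (d + 1) ℝ) (κ : Fin (d + 1)) (x : Site (d + 1)),
      𝓘 lev rs (n + 1) H B κ x
        = (((Lc : ℝ) ^ (d + 1) * stepScale d Lc (lev 1)) * (∏ i ∈ Finset.range n, (stepScale d Lc (lev (i + 1 + 1)) * ((box (d + 1) Lc).card : ℝ)))⁻¹) *
            (∑' u : Site (d + 1), ∑ κ' : Fin (d + 1),
              (∑' z : Site (d + 1), ∑ l : Fin (d + 1), vhKerAt (toSite (rs 1)) Lc κ x (l, z) (κ', u) *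
                ((∏ i ∈ Finset.range n, stepScale d Lc (lev (i + 1 + 1))) * compLinAvgAt (fun i => rs (n - i + 1)) Lc n B l z)) *
              ((∏ i ∈ Finset.range n, stepScale d Lc (lev (i + 1 + 1))) * compLinAvgAt (fun i => rs (n - i + 1)) Lc n H κ' u))
          + stepScale d Lc (lev 1) * linAvgAt (toSite (rs 1)) (𝓘 (fun k => lev (k + 1)) (fun k => rs (k + 1)) n H B) Lc κ x)
    (n : ℕ) (M : Fin (d + 1) → ℕ) [∀ μ, NeZero (M μ)] (lev : ℕ → ℕ) (rs : ℕ → (Fin (d + 1) → ℕ)) (hrs : ∀ k, rs k ∈ box (d + 1) Lc)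
    (K : Fin (d + 1) → Site (d + 1) → Bond (d + 1) → Bond (d + 1) → ℝ) (cu : ℝ) (WK : Site (d + 1) → Finset (Site (d + 1)))
    (hKz : ∀ (μ : Fin (d + 1)) (x : Site (d + 1)) (α κ' : Fin (d + 1)) (u : Site (d + 1)), ∀ z ∉ WK x, K μ x (α, z) (κ', u) = 0)
    (hKu : ∀ (μ : Fin (d + 1)) (x : Site (d + 1)) (α : Fin (d + 1)) (z : Site (d + 1)) (κ' : Fin (d + 1)), ∀ u ∉ WK x, K μ x (α, z) (κ', u) = 0)
    (hVt : ∀ (κ' : Fin (d + 1)) (u t : Site (d + 1)), packVH K (Lc ^ n) κ' (u + (((Lc ^ n : ℕ) : ℤ)) • t) = shiftK (-((((Lc ^ n : ℕ) : ℤ)) • t)) (packVH K (Lc ^ n) κ' u))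
    (h𝓘 : ∀ (H B : Form1 (d + 1) ℝ) (κ : Fin (d + 1)) (x : Site (d + 1)), 𝓘 lev rs n H B κ x
      = cu * ∑' u : Site (d + 1), ∑ κ' : Fin (d + 1), (∑' z : Site (d + 1), ∑ l : Fin (d + 1), K κ x (l, z) (κ', u) * B l z) * H κ' u)

include h0 hsucc hrs hKz hKu hVt h𝓘

/-- [folklore] **R-9 AT A PACKED BORDER FAMILY** — for `𝒱 κ′ u := cu • packVH K (Lc^n) κ′ u` with the kernel-functional identity `h𝓘` at depth `n` (the row's naming of
`𝓘₁` by R-13, unit `cu`), the kernel's windows `hKz ∕ hKu` and the packed family's block covariance `hVt`: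
`Σ_b h b · perZ T (dper T (cu • packVH K (Lc^n) b.2 b.1)) (Lc^n • x̄) z (inr κ) (inl β) = compIns₁ Lc M lev rs n h (x̄, κ) (z, β)`. -/
theorem sum_mul_perZ_dper_packVH_eq_compIns₁_apply
    (h : ↥(pbox (towerTorus Lc M n)) × Fin (d + 1) → ℝ) (x : ↥(pbox M)) (κ : Fin (d + 1)) (z : ↥(pbox (towerTorus Lc M n))) (β : Fin (d + 1)) :
    ∑ b : ↥(pbox (towerTorus Lc M n)) × Fin (d + 1), h b *
        perZ (towerTorus Lc M n) (dper (towerTorus Lc M n) (cu • packVH K (Lc ^ n) b.2 (b.1 : Site (d + 1)))) ((((Lc ^ n : ℕ) : ℤ)) • (x : Site (d + 1))) (z : Site (d + 1))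
          (Sum.inr κ) (Sum.inl β)
      = compIns₁ Lc M lev rs n h (x, κ) (z, β) := by
  have hN : 1 ≤ Lc ^ n := Nat.one_le_iff_ne_zero.mpr (pow_ne_zero _ (NeZero.ne Lc))
  refine sum_mul_perZ_dper_eq_compIns₁_apply Lc 𝓘 h0 hsucc n M lev rs hrs (fun κ' u => cu • packVH K (Lc ^ n) κ' u) (fun X => WK (blk (Lc ^ n) X))
    (fun κ' u t => ?_) (fun κ' u X μ α z hz => smul_packVH_inr_inl_eq_zero _ K cu κ' u X z μ α (hKz μ _ α κ' u z hz))
    (fun κ' X z μ α u hu => smul_packVH_inr_inl_eq_zero _ K cu κ' u X z μ α (hKu μ _ α z κ' u hu)) (fun H B κ x => ?_) h x κ z β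
  · show cu • packVH K (Lc ^ n) κ' (u + (((Lc ^ n : ℕ) : ℤ)) • t) = shiftK (-((((Lc ^ n : ℕ) : ℤ)) • t)) (cu • packVH K (Lc ^ n) κ' u)
    rw [hVt]
    rfl
  · rw [h𝓘, ← tsum_mul_left]
    exact tsum_congr fun u => by
      rw [Finset.mul_sum]
      refine Finset.sum_congr rfl fun κ' _ => ?_
      rw [← mul_assoc, ← tsum_mul_left]
      refine congrArg (fun t : ℝ => t * _) (tsum_congr fun z => ?_)
      rw [Finset.mul_sum]
      exact Finset.sum_congr rfl fun l _ => by rw [smul_packVH_zsmul_inr_inl hN, mul_assoc]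

/-- [folklore] the same AT ONE LATTICE-LABELLED BOND, every box (R-11 §1 at the packed family): `perZ T (dper T (cu • packVH K (Lc^n) κ′ u)) (Lc^n • x̄) z (inr κ) (inl β)
= compIns₁ Lc M lev rs n δ_{(wrapPt T u, κ′)} (x̄, κ) (z, β)` — #41d ∕ #42a's `hQF₁ ∕ hQF₁′` (and, one storey up via R-12, `hQN₁ ∕ hQN₁′`'s undressed summand). -/
theorem perZ_dper_packVH_eq_compIns₁_apply_single
    (κ' : Fin (d + 1)) (u : Site (d + 1)) (x : ↥(pbox M)) (κ : Fin (d + 1)) (z : ↥(pbox (towerTorus Lc M n))) (β : Fin (d + 1)) :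
    perZ (towerTorus Lc M n) (dper (towerTorus Lc M n) (cu • packVH K (Lc ^ n) κ' u)) ((((Lc ^ n : ℕ) : ℤ)) • (x : Site (d + 1))) (z : Site (d + 1)) (Sum.inr κ) (Sum.inl β)
      = compIns₁ Lc M lev rs n (fun b => if b = (wrapPt (towerTorus Lc M n) u, κ') then 1 else 0) (x, κ) (z, β) := by
  have hN : 1 ≤ Lc ^ n := Nat.one_le_iff_ne_zero.mpr (pow_ne_zero _ (NeZero.ne Lc))
  refine perZ_dper_eq_compIns₁_apply_single Lc 𝓘 h0 hsucc n M lev rs hrs (fun κ' u => cu • packVH K (Lc ^ n) κ' u) (fun X => WK (blk (Lc ^ n) X))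
    (fun κ' u t => ?_) (fun κ' u X μ α z hz => smul_packVH_inr_inl_eq_zero _ K cu κ' u X z μ α (hKz μ _ α κ' u z hz))
    (fun κ' X z μ α u hu => smul_packVH_inr_inl_eq_zero _ K cu κ' u X z μ α (hKu μ _ α z κ' u hu)) (fun H B κ x => ?_) κ' u x κ z β
  · show cu • packVH K (Lc ^ n) κ' (u + (((Lc ^ n : ℕ) : ℤ)) • t) = shiftK (-((((Lc ^ n : ℕ) : ℤ)) • t)) (cu • packVH K (Lc ^ n) κ' u)
    rw [hVt]
    rfl
  · rw [h𝓘, ← tsum_mul_left]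
    exact tsum_congr fun u => by
      rw [Finset.mul_sum]
      refine Finset.sum_congr rfl fun κ' _ => ?_
      rw [← mul_assoc, ← tsum_mul_left]
      refine congrArg (fun t : ℝ => t * _) (tsum_congr fun z => ?_)
      rw [Finset.mul_sum]
      exact Finset.sum_congr rfl fun l _ => by rw [smul_packVH_zsmul_inr_inl hN, mul_assoc]

end OrderOne

/-! ## §2 Order 2: R-10 ∕ R-11 at a packed two-bond border family -/

section OrderTwo

variable
    (𝓘₁ : (ℕ → ℕ) → (ℕ → (Fin (d + 1) → ℕ)) → ℕ → Form1 (d + 1) ℝ → Form1 (d + 1) ℝ → Form1 (d + 1) ℝ)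
    (h0₁ : ∀ (lev : ℕ → ℕ) (rs : ℕ → (Fin (d + 1) → ℕ)) (H B : Form1 (d + 1) ℝ), 𝓘₁ lev rs 0 H B = 0)
    (hsucc₁ : ∀ (lev : ℕ → ℕ) (rs : ℕ → (Fin (d + 1) → ℕ)) (n : ℕ) (H B : Form1 (d + 1) ℝ) (κ : Fin (d + 1)) (x : Site (d + 1)),
      𝓘₁ lev rs (n + 1) H B κ x
        = (((Lc : ℝ) ^ (d + 1) * stepScale d Lc (lev 1)) * (∏ i ∈ Finset.range n, (stepScale d Lc (lev (i + 1 + 1)) * ((box (d + 1) Lc).card : ℝ)))⁻¹) *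
            (∑' u : Site (d + 1), ∑ κ' : Fin (d + 1),
              (∑' z : Site (d + 1), ∑ l : Fin (d + 1), vhKerAt (toSite (rs 1)) Lc κ x (l, z) (κ', u) *
                ((∏ i ∈ Finset.range n, stepScale d Lc (lev (i + 1 + 1))) * compLinAvgAt (fun i => rs (n - i + 1)) Lc n B l z)) *
              ((∏ i ∈ Finset.range n, stepScale d Lc (lev (i + 1 + 1))) * compLinAvgAt (fun i => rs (n - i + 1)) Lc n H κ' u))
          + stepScale d Lc (lev 1) * linAvgAt (toSite (rs 1)) (𝓘₁ (fun k => lev (k + 1)) (fun k => rs (k + 1)) n H B) Lc κ x)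
    (𝓘₂ : (ℕ → ℕ) → (ℕ → (Fin (d + 1) → ℕ)) → ℕ → Form1 (d + 1) ℝ → Form1 (d + 1) ℝ → Form1 (d + 1) ℝ → Form1 (d + 1) ℝ)
    (h0₂ : ∀ (lev : ℕ → ℕ) (rs : ℕ → (Fin (d + 1) → ℕ)) (H H' B : Form1 (d + 1) ℝ), 𝓘₂ lev rs 0 H H' B = 0)
    (hsucc₂ : ∀ (lev : ℕ → ℕ) (rs : ℕ → (Fin (d + 1) → ℕ)) (n : ℕ) (H H' B : Form1 (d + 1) ℝ) (κ₀ : Fin (d + 1)) (x : Site (d + 1)),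
      𝓘₂ lev rs (n + 1) H H' B κ₀ x
        = ((((Lc : ℝ) ^ (d + 1) * stepScale d Lc (lev 1)) * (∏ i ∈ Finset.range n, (stepScale d Lc (lev (i + 1 + 1)) * ((box (d + 1) Lc).card : ℝ)))⁻¹) * (∏ i ∈ Finset.range n, (stepScale d Lc (lev (i + 1 + 1)) * ((box (d + 1) Lc).card : ℝ)))⁻¹) *
            (∑' u : Site (d + 1), ∑ κ : Fin (d + 1), (∑' u' : Site (d + 1), ∑ κ' : Fin (d + 1),
              (∑' z : Site (d + 1), ∑ l : Fin (d + 1),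
                (1 / 2 : ℝ) * (vh2KerAt (toSite (rs 1)) Lc κ₀ x (l, z) (κ, u) (κ', u') + vh2KerAt (toSite (rs 1)) Lc κ₀ x (l, z) (κ', u') (κ, u)) *
                  ((∏ i ∈ Finset.range n, stepScale d Lc (lev (i + 1 + 1))) * compLinAvgAt (fun i => rs (n - i + 1)) Lc n B l z)) *
              ((∏ i ∈ Finset.range n, stepScale d Lc (lev (i + 1 + 1))) * compLinAvgAt (fun i => rs (n - i + 1)) Lc n H' κ' u')) *
              ((∏ i ∈ Finset.range n, stepScale d Lc (lev (i + 1 + 1))) * compLinAvgAt (fun i => rs (n - i + 1)) Lc n H κ u))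
          + (((Lc : ℝ) ^ (d + 1) * stepScale d Lc (lev 1)) * (∏ i ∈ Finset.range n, (stepScale d Lc (lev (i + 1 + 1)) * ((box (d + 1) Lc).card : ℝ)))⁻¹) *
            ((∑' u : Site (d + 1), ∑ κ' : Fin (d + 1),
              (∑' z : Site (d + 1), ∑ l : Fin (d + 1), vhKerAt (toSite (rs 1)) Lc κ₀ x (l, z) (κ', u) * 𝓘₁ (fun k => lev (k + 1)) (fun k => rs (k + 1)) n H' B l z) *
                ((∏ i ∈ Finset.range n, stepScale d Lc (lev (i + 1 + 1))) * compLinAvgAt (fun i => rs (n - i + 1)) Lc n H κ' u))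
            + (∑' u : Site (d + 1), ∑ κ' : Fin (d + 1),
              (∑' z : Site (d + 1), ∑ l : Fin (d + 1), vhKerAt (toSite (rs 1)) Lc κ₀ x (l, z) (κ', u) * 𝓘₁ (fun k => lev (k + 1)) (fun k => rs (k + 1)) n H B l z) *
                ((∏ i ∈ Finset.range n, stepScale d Lc (lev (i + 1 + 1))) * compLinAvgAt (fun i => rs (n - i + 1)) Lc n H' κ' u)))
          + stepScale d Lc (lev 1) * linAvgAt (toSite (rs 1)) (𝓘₂ (fun k => lev (k + 1)) (fun k => rs (k + 1)) n H H' B) Lc κ₀ x)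
    (n : ℕ) (M : Fin (d + 1) → ℕ) [∀ μ, NeZero (M μ)] (lev : ℕ → ℕ) (rs : ℕ → (Fin (d + 1) → ℕ)) (hrs : ∀ k, rs k ∈ box (d + 1) Lc)
    (K₂ : Fin (d + 1) → Site (d + 1) → Bond (d + 1) → Bond (d + 1) → Bond (d + 1) → ℝ) (cu : ℝ) (WK : Site (d + 1) → Finset (Site (d + 1)))
    (hK2z : ∀ (μ : Fin (d + 1)) (x : Site (d + 1)) (α : Fin (d + 1)) (f₁ f₂ : Bond (d + 1)), ∀ z ∉ WK x, K₂ μ x (α, z) f₁ f₂ = 0)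
    (hK2u : ∀ (μ : Fin (d + 1)) (x : Site (d + 1)) (f : Bond (d + 1)) (κ : Fin (d + 1)) (f₂ : Bond (d + 1)), ∀ u ∉ WK x, K₂ μ x f (κ, u) f₂ = 0)
    (hK2u' : ∀ (μ : Fin (d + 1)) (x : Site (d + 1)) (f f₁ : Bond (d + 1)) (κ' : Fin (d + 1)), ∀ u' ∉ WK x, K₂ μ x f f₁ (κ', u') = 0)
    (hWt : ∀ (κ : Fin (d + 1)) (u : Site (d + 1)) (κ' : Fin (d + 1)) (u' t : Site (d + 1)),
      packVH (fun μ y f f' => K₂ μ y f (κ, u + (((Lc ^ n : ℕ) : ℤ)) • t) f') (Lc ^ n) κ' (u' + (((Lc ^ n : ℕ) : ℤ)) • t)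
        = shiftK (-((((Lc ^ n : ℕ) : ℤ)) • t)) (packVH (fun μ y f f' => K₂ μ y f (κ, u) f') (Lc ^ n) κ' u'))
    (h𝓘₂ : ∀ (H H' B : Form1 (d + 1) ℝ) (κ₀ : Fin (d + 1)) (x : Site (d + 1)), 𝓘₂ lev rs n H H' B κ₀ x
      = cu * ∑' u : Site (d + 1), ∑ κ : Fin (d + 1), (∑' u' : Site (d + 1), ∑ κ' : Fin (d + 1),
          (∑' z : Site (d + 1), ∑ l : Fin (d + 1), K₂ κ₀ x (l, z) (κ, u) (κ', u') * B l z) * H' κ' u') * H κ u)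

include h0₁ hsucc₁ h0₂ hsucc₂ hrs hK2z hK2u hK2u' hWt h𝓘₂

omit hWt in
/-- [folklore] **R-10 AT A PACKED TWO-BOND BORDER FAMILY** — for `𝒲 κ u κ′ u′ := cu • packVH (fun μ y f f′ => K₂ μ y f (κ,u) f′) (Lc^n) κ′ u′` (an2 F5's `compVh2S`
shape: an1's packer closed over the first background bond) with the bi-kernel-functional identity `h𝓘₂` (unit `cu`), the kernel's windows in its three fine slots and the
packed family windowed (`hWt` is not needed here): ALL pairs of copies load — R-10's identity, exact at every box. -/
theorem sum_sum_mul_tsum₂_packVH_eq_compIns₂₂_apply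
    (h h' : ↥(pbox (towerTorus Lc M n)) × Fin (d + 1) → ℝ) (x : ↥(pbox M)) (κ₀ : Fin (d + 1)) (z : ↥(pbox (towerTorus Lc M n))) (β : Fin (d + 1)) :
    ∑ b : ↥(pbox (towerTorus Lc M n)) × Fin (d + 1), ∑ b' : ↥(pbox (towerTorus Lc M n)) × Fin (d + 1), h b * (h' b' *
        ∑' m₁ : Site (d + 1), ∑' m₂ : Site (d + 1), ∑' m : Site (d + 1),
          (cu • packVH (fun μ y f f' => K₂ μ y f (b.2, translate (towerTorus Lc M n) (b.1 : Site (d + 1)) m₁) f') (Lc ^ n) b'.2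
              (translate (towerTorus Lc M n) (b'.1 : Site (d + 1)) m₂))
            ((((Lc ^ n : ℕ) : ℤ)) • (x : Site (d + 1))) (translate (towerTorus Lc M n) (z : Site (d + 1)) m) (Sum.inr κ₀) (Sum.inl β))
      = compIns₂₂ Lc M lev rs n h h' (x, κ₀) (z, β) := by
  have hN : 1 ≤ Lc ^ n := Nat.one_le_iff_ne_zero.mpr (pow_ne_zero _ (NeZero.ne Lc))
  refine sum_sum_mul_tsum₂_eq_compIns₂₂_apply Lc 𝓘₁ h0₁ hsucc₁ 𝓘₂ h0₂ hsucc₂ n M lev rs hrs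
    (fun κ u κ' u' => cu • packVH (fun μ y f f' => K₂ μ y f (κ, u) f') (Lc ^ n) κ' u') (fun X => WK (blk (Lc ^ n) X))
    (fun κ u κ' u' X μ α z hz => smul_packVH_inr_inl_eq_zero _ _ cu κ' u' X z μ α (hK2z μ _ α _ _ z hz))
    (fun κ κ' u' X z μ α u hu => smul_packVH_inr_inl_eq_zero _ _ cu κ' u' X z μ α (hK2u μ _ _ κ _ u hu))
    (fun κ u κ' X z μ α u' hu' => smul_packVH_inr_inl_eq_zero _ _ cu κ' u' X z μ α (hK2u' μ _ _ _ κ' u' hu')) (fun H H' B κ₀ x => ?_) h h' x κ₀ z β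
  rw [h𝓘₂, ← tsum_mul_left]
  refine tsum_congr fun u => ?_
  rw [Finset.mul_sum]
  refine Finset.sum_congr rfl fun κ _ => ?_
  rw [← mul_assoc, ← tsum_mul_left]
  refine congrArg (fun t : ℝ => t * _) (tsum_congr fun u' => ?_)
  rw [Finset.mul_sum]
  refine Finset.sum_congr rfl fun κ' _ => ?_
  rw [← mul_assoc, ← tsum_mul_left]
  refine congrArg (fun t : ℝ => t * _) (tsum_congr fun z => ?_)
  rw [Finset.mul_sum]
  exact Finset.sum_congr rfl fun l _ => by rw [smul_packVH_zsmul_inr_inl hN, mul_assoc]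

/-- [folklore] **THE ORDER-2 SOCKET AT A PACKED TWO-BOND BORDER FAMILY, UNDER THE `K₀` GUARD** (R-11 `…_of_diam` at the packed family): with the kernel's window at the
coarse site `x̄` of `ℓ^∞`-diameter `≤ D` and `D + |u i − u′ i| < T i` in every direction,
`perZ T (dper T (cu • packVH (fun μ y f f′ => K₂ μ y f (κ,u) f′) (Lc^n) κ′ u′)) (Lc^n • x̄) z (inr κ₀) (inl β) = compIns₂₂ Lc M lev rs n δ_{(wrapPt T u, κ)} δ_{(wrapPt T u′, κ′)} (x̄, κ₀) (z, β)`
— #41d ∕ #42a's `hQF₂` (and via R-12 `hQN₂`'s undressed summand) at the row's packed family, for boxes beyond `K₀`. -/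
theorem perZ_dper_packVH_eq_compIns₂₂_apply_single_of_diam
    (κ : Fin (d + 1)) (u : Site (d + 1)) (κ' : Fin (d + 1)) (u' : Site (d + 1))
    (x : ↥(pbox M)) (κ₀ : Fin (d + 1)) (z : ↥(pbox (towerTorus Lc M n))) (β : Fin (d + 1)) (D : ℤ)
    (hD : ∀ v ∈ WK (x : Site (d + 1)), ∀ v' ∈ WK (x : Site (d + 1)), ∀ i : Fin (d + 1), |v i - v' i| ≤ D)
    (hK : ∀ i : Fin (d + 1), D + |u i - u' i| < (towerTorus Lc M n i : ℤ)) :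
    perZ (towerTorus Lc M n) (dper (towerTorus Lc M n) (cu • packVH (fun μ y f f' => K₂ μ y f (κ, u) f') (Lc ^ n) κ' u'))
        ((((Lc ^ n : ℕ) : ℤ)) • (x : Site (d + 1))) (z : Site (d + 1)) (Sum.inr κ₀) (Sum.inl β)
      = compIns₂₂ Lc M lev rs n (fun b => if b = (wrapPt (towerTorus Lc M n) u, κ) then 1 else 0)
          (fun b => if b = (wrapPt (towerTorus Lc M n) u', κ') then 1 else 0) (x, κ₀) (z, β) := by
  have hN : 1 ≤ Lc ^ n := Nat.one_le_iff_ne_zero.mpr (pow_ne_zero _ (NeZero.ne Lc))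
  have hD' : ∀ v ∈ WK (blk (Lc ^ n) ((((Lc ^ n : ℕ) : ℤ)) • (x : Site (d + 1)))), ∀ v' ∈ WK (blk (Lc ^ n) ((((Lc ^ n : ℕ) : ℤ)) • (x : Site (d + 1)))),
      ∀ i : Fin (d + 1), |v i - v' i| ≤ D := by
    rw [blk_zsmul hN]
    exact hD
  refine perZ_dper_eq_compIns₂₂_apply_single_of_diam Lc 𝓘₁ h0₁ hsucc₁ 𝓘₂ h0₂ hsucc₂ n M lev rs hrs
    (fun κ u κ' u' => cu • packVH (fun μ y f f' => K₂ μ y f (κ, u) f') (Lc ^ n) κ' u') (fun X => WK (blk (Lc ^ n) X))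
    (fun κ u κ' u' t => ?_)
    (fun κ u κ' u' X μ α z hz => smul_packVH_inr_inl_eq_zero _ _ cu κ' u' X z μ α (hK2z μ _ α _ _ z hz))
    (fun κ κ' u' X z μ α u hu => smul_packVH_inr_inl_eq_zero _ _ cu κ' u' X z μ α (hK2u μ _ _ κ _ u hu))
    (fun κ u κ' X z μ α u' hu' => smul_packVH_inr_inl_eq_zero _ _ cu κ' u' X z μ α (hK2u' μ _ _ _ κ' u' hu')) (fun H H' B κ₀ x => ?_)
    κ u κ' u' x κ₀ z β D hD' hK
  · show cu • packVH (fun μ y f f' => K₂ μ y f (κ, u + (((Lc ^ n : ℕ) : ℤ)) • t) f') (Lc ^ n) κ' (u' + (((Lc ^ n : ℕ) : ℤ)) • t)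
        = shiftK (-((((Lc ^ n : ℕ) : ℤ)) • t)) (cu • packVH (fun μ y f f' => K₂ μ y f (κ, u) f') (Lc ^ n) κ' u')
    rw [hWt]
    rfl
  · rw [h𝓘₂, ← tsum_mul_left]
    refine tsum_congr fun u => ?_
    rw [Finset.mul_sum]
    refine Finset.sum_congr rfl fun κ _ => ?_
    rw [← mul_assoc, ← tsum_mul_left]
    refine congrArg (fun t : ℝ => t * _) (tsum_congr fun u' => ?_)
    rw [Finset.mul_sum]
    refine Finset.sum_congr rfl fun κ' _ => ?_
    rw [← mul_assoc, ← tsum_mul_left]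
    refine congrArg (fun t : ℝ => t * _) (tsum_congr fun z => ?_)
    rw [Finset.mul_sum]
    exact Finset.sum_congr rfl fun l _ => by rw [smul_packVH_zsmul_inr_inl hN, mul_assoc]

end OrderTwo

end Summit.QuantumFields.BalabanUV.Beta.FP.TorusCompositeInsertionKernelPacked

end
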